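import Summits.CriticalPhenomena.Ising3DConformalLimit.Theorems.EnergyNotSigmaSquaredGapForcesFarMergingSandwichDefs
import Literature.Probability.LatticeModels.SourcedDoubleCurrentsOneArmMoments
import HarnessLib

/-!
# One-pinch decay, auxiliary file 1: the dictionary `avoid ≤ 1 - merge` from the double sandwich
(line `one-cluster-depletion-sandwich` of crux `GapForcesFarMerging`, item stmt-CriticalPhenomena-4468;
helper for the registered stub `stub_onePinchDecay`, lead seat c1)

The hypothesis `DoubleSandwich` of the line (Defs module
`…EnergyNotSigmaSquaredGapForcesFarMergingSandwichDefs`) is an un-normalised current-sum inequality on an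
arbitrary finite graph: for vertices `o x a x'` and couplings `K ≥ 0`,
`∑ 1{∂n₁=ox}1{∂n₂=∅}1{∂n₃=ax'}1{∂n₄=∅} w⁴ 𝟙[C_{n₁+n₂}(o) ∩ C_{n₃+n₄}(a) = ∅]
  ≤ Z[∅]² · ∑ 1{∂n₁=ox}1{∂n₃=ax'} w w 𝟙[a ∉ C_{n₁+n₃}(o)]`.
Here it is read on the free box graph `freeBoxGraph 3 n` of `Λ_n ⊂ ℤ³` at `β_c(3)` and divided by
`Z[ox] Z[ax'] Z[∅]²`: the left side becomes the duplicated avoidance probability `avoid n y` of the two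
independent lifted traces (`fourTraceLaw`, a product of two push-forwards of `doubleCurrentMeasure` under
`sourcedTrace`; product measures of sets on countable discrete spaces are series of products of singleton
masses, `P^{A,B}_{Λ}{p} = w(p)/(Z[A]Z[B])`), the right side becomes `1 - merge n y`, the two-current
avoidance probability `P^{y₀y₁,y₂y₃}_{Λ_n}[y₀ ↮ y₂]` (lifting does not change connections,
`liftBonds_mem_openConn_iff`). Result: `avoid n y ≤ 1 - merge n y` as soon as the four points lie in `Λ_n`
(`onePinchDecay_avoid_le_one_sub_merge`).

References: Aizenman–Duminil-Copin 2021 (arXiv:1912.07973) §3.1–3.2, eq. (3.13), App. A Lemma A.1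
[AizenmanDuminilCopinAnnals2021]; Aizenman 1982, Lemma 9.3 [AizenmanCMP1982].
-/

noncomputable section

namespace Summit.CriticalPhenomena.Ising3DConformalLimit.EnergyNotSigmaSquaredGapForcesFarMergingSandwich

namespace OnePinchDecayProof

open scoped symmDiff ENNReal
open MeasureTheory Filter
open Literature.Probability.LatticeModels Literature.Probability.Percolation
open Summit.CriticalPhenomena.Ising3DConformalLimit.GapForcesFarMergingSandwich
open Summit.CriticalPhenomena.Ising3DConformalLimit.Theses.EnergyNotSigmaSquared

/-! ## Product measures on countable discrete spaces -/

/-- The product measure of a set on countable discrete spaces, as a series over points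
(same computation as in `Theorems.IsingEuclidUpgradeR4NonGaussianSecondMomentBox`). [folklore] -/
theorem prod_apply_eq_tsum {α γ : Type*} [MeasurableSpace α] [MeasurableSpace γ]
    [Countable α] [Countable γ] [MeasurableSingletonClass α] [MeasurableSingletonClass γ]
    (μ : Measure α) (ν : Measure γ) [SFinite ν] (S : Set (α × γ)) :
    μ.prod ν S = ∑' pq : α × γ, μ {pq.1} * ν {pq.2} * S.indicator 1 pq := by
  -- adapted from Theorems/IsingEuclidUpgradeR4NonGaussianSecondMomentBox.lean (`prod_apply_eq_tsum`)
  classical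
  have hS : MeasurableSet S := S.to_countable.measurableSet
  rw [Measure.prod_apply hS, lintegral_countable', ENNReal.tsum_prod']
  refine tsum_congr fun p => ?_
  rw [← Measure.tsum_indicator_apply_singleton ν (Prod.mk p ⁻¹' S)
    (Set.to_countable _).measurableSet, ← ENNReal.tsum_mul_right]
  refine tsum_congr fun q => ?_
  by_cases h : (p, q) ∈ S
  · rw [Set.indicator_of_mem (show q ∈ Prod.mk p ⁻¹' S from h), Set.indicator_of_mem h,
      Pi.one_apply, mul_one, mul_comm]
  · rw [Set.indicator_of_notMem (show q ∉ Prod.mk p ⁻¹' S from h), Set.indicator_of_notMem h,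
      mul_zero, zero_mul]

/-! ## Measurability of the meeting event -/

/-- The meeting event is a countable union of products of connection events, hence measurable. [folklore] -/
theorem measurableSet_meet (y : Fin 4 → Site 3) : MeasurableSet (Meet y) := by
  have h : Meet y = ⋃ u : Site 3, (openConn (y 0) u) ×ˢ (openConn (y 2) u) := by
    ext ω
    simp only [Meet, Set.mem_setOf_eq, Set.mem_iUnion, Set.mem_prod, openCluster, openConn]
  rw [h]
  exact MeasurableSet.iUnion fun u =>
    (measurableSet_openConn_holds (y 0) u).prod (measurableSet_openConn_holds (y 2) u)

/-! ## Sources inside the box -/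

/-- A pair of box points is a source set inside the box. [folklore] -/
theorem pair_subset_box {n : ℕ} {p q : Site 3} (hp : p ∈ box 3 n) (hq : q ∈ box 3 n) :
    (({p} : Finset (Site 3)) ∆ {q}) ⊆ box 3 n := by
  intro z hz
  rcases Finset.mem_symmDiff.1 hz with ⟨hz, -⟩ | ⟨hz, -⟩
  · rw [Finset.mem_singleton.1 hz]; exact hp
  · rw [Finset.mem_singleton.1 hz]; exact hq

/-- Currents of the free box graph with a pair of sources inside `Λ_n` exist (`Z[{o}∆{x}] ≠ 0`). [folklore] -/
theorem currentSum_pair_ne_zero {n : ℕ} (o x : BoxVertex 3 n) (ho : (o : Site 3) ∈ box 3 n)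
    (hx : (x : Site 3) ∈ box 3 n) :
    currentSum (freeBoxGraph 3 n) βc ({o} ∆ {x}) ≠ 0 := by
  have h := currentSum_boxSources_pos 3 (criticalBeta_pos_holds (d := 3) (by norm_num))
    (pair_subset_box ho hx) (even_card_singleton_symmDiff _ _)
  rw [boxSources_pair] at h
  exact h.ne'

/-- Sourceless currents of the free box graph exist (`Z[∅] ≠ 0`). [folklore] -/
theorem currentSum_empty_ne_zero (n : ℕ) :
    currentSum (freeBoxGraph 3 n) βc (∅ : Finset (BoxVertex 3 n)) ≠ 0 := by
  have h := currentSum_boxSources_pos 3 (criticalBeta_pos_holds (d := 3) (by norm_num))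
    (Finset.empty_subset (box 3 n)) (by simp)
  rw [boxSources_empty] at h
  exact h.ne'

/-! ## The sandwich in probability form on a finite graph -/

/-- Product of two double-current measures of a finite graph on a set of pairs of pairs of currents:
`(P^{A,B} ⊗ P^{A',B'})[S] = (∑ w_{A,B}(q₁) w_{A',B'}(q₂) 𝟙_S(q)) / (Z[A]Z[B]Z[A']Z[B'])`
(nondegenerate normalisers, `β ≥ 0`). [cite: AizenmanDuminilCopinAnnals2021, §3.1] -/
theorem prod_doubleCurrentMeasure_apply {V : Type*} [Fintype V] [DecidableEq V] (G : SimpleGraph V)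
    [DecidableRel G.Adj] {β : ℝ} (hβ : 0 ≤ β) {A B A' B' : Finset V}
    (hA : currentSum G β A ≠ 0) (hB : currentSum G β B ≠ 0) (hA' : currentSum G β A' ≠ 0)
    (hB' : currentSum G β B' ≠ 0) (S : Set ((Current G × Current G) × (Current G × Current G))) :
    ((doubleCurrentMeasure G β A B).prod (doubleCurrentMeasure G β A' B')) S =
      (∑' q, epairWeight (fun _ : G.edgeFinset => β) A B q.1 *
          epairWeight (fun _ : G.edgeFinset => β) A' B' q.2 * S.indicator 1 q) /
        (ecurrentSum (fun _ : G.edgeFinset => β) A * ecurrentSum (fun _ : G.edgeFinset => β) B *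
          (ecurrentSum (fun _ : G.edgeFinset => β) A' * ecurrentSum (fun _ : G.edgeFinset => β) B')) := by
  -- adapted from Theorems/IsingEuclidUpgradeR4NonGaussianSecondMomentBox.lean (`hP4` in `boxMoment₁_sq_le`)
  haveI := isProbabilityMeasure_doubleCurrentMeasure_holds G hβ hA' hB'
  have hK : ∀ e : G.edgeFinset, 0 ≤ (fun _ : G.edgeFinset => β) e := fun _ => hβ
  have hZtop : ∀ T, ecurrentSum (fun _ : G.edgeFinset => β) T ≠ ∞ := fun T => ecurrentSum_ne_top hK T
  have hZne : ∀ T, currentSum G β T ≠ 0 → ecurrentSum (fun _ : G.edgeFinset => β) T ≠ 0 :=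
    fun T hT h => hT (by rw [currentSum_eq_wcurrentSum, ← toReal_ecurrentSum hK, h, ENNReal.toReal_zero])
  rw [prod_apply_eq_tsum, div_eq_mul_inv, ← ENNReal.tsum_mul_right]
  refine tsum_congr fun q => ?_
  rw [doubleCurrentMeasure_singleton_eq_div G β hβ A B hA hB,
    doubleCurrentMeasure_singleton_eq_div G β hβ A' B' hA' hB',
    ENNReal.mul_inv (Or.inl (mul_ne_zero (hZne A hA) (hZne B hB)))
      (Or.inl (ENNReal.mul_ne_top (hZtop _) (hZtop _))), div_eq_mul_inv, div_eq_mul_inv]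
  ring

/-- **The double sandwich, normalised** (finite graph, `β ≥ 0`, nondegenerate normalisers):
`P^{ox,∅} ⊗ P^{ax',∅}[C_{n₁+n₂}(o) ∩ C_{n₃+n₄}(a) = ∅] ≤ P^{ox,ax'}[a ∉ C_{n₁+n₃}(o)]` — the hypothesis
`DoubleSandwich` divided by `Z[ox] Z[ax'] Z[∅]²`. [cite: AizenmanDuminilCopinAnnals2021, App. A Lemma A.1] -/
theorem sandwich_prob {V : Type} [Fintype V] [DecidableEq V] (G : SimpleGraph V) [DecidableRel G.Adj]
    (hDS : DoubleSandwich) {β : ℝ} (hβ : 0 ≤ β) (o x a x' : V)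
    (hox : currentSum G β ({o} ∆ {x}) ≠ 0) (hax : currentSum G β ({a} ∆ {x'}) ≠ 0)
    (h0 : currentSum G β ∅ ≠ 0) :
    ((doubleCurrentMeasure G β ({o} ∆ {x}) ∅).prod (doubleCurrentMeasure G β ({a} ∆ {x'}) ∅))
        {q | Disjoint ((q.1.1 + q.1.2).cluster o) ((q.2.1 + q.2.2).cluster a)} ≤
      (doubleCurrentMeasure G β ({o} ∆ {x}) ({a} ∆ {x'})) {p | a ∉ (p.1 + p.2).cluster o} := by
  have hK : ∀ e : G.edgeFinset, 0 ≤ (fun _ : G.edgeFinset => β) e := fun _ => hβ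
  have hZtop : ∀ T, ecurrentSum (fun _ : G.edgeFinset => β) T ≠ ∞ := fun T => ecurrentSum_ne_top hK T
  have hZ0 : ecurrentSum (fun _ : G.edgeFinset => β) (∅ : Finset V) ≠ 0 := ecurrentSum_empty_ne_zero _
  have key := hDS V G (fun _ => β) hK o x a x'
  have key' : (∑' q : (Current G × Current G) × (Current G × Current G),
      epairWeight (fun _ : G.edgeFinset => β) ({o} ∆ {x}) ∅ q.1 *
        epairWeight (fun _ : G.edgeFinset => β) ({a} ∆ {x'}) ∅ q.2 *
          Set.indicator {q | Disjoint ((q.1.1 + q.1.2).cluster o) ((q.2.1 + q.2.2).cluster a)} 1 q) ≤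
      ecurrentSum (fun _ : G.edgeFinset => β) (∅ : Finset V) ^ 2 *
        ∑' p : Current G × Current G, epairWeight (fun _ : G.edgeFinset => β) ({o} ∆ {x}) ({a} ∆ {x'}) p *
          Set.indicator {p | a ∉ (p.1 + p.2).cluster o} 1 p := by
    convert key using 2
    · funext q
      simp only [Set.indicator_apply, Set.mem_setOf_eq, Pi.one_apply]
    · congr 1
      funext p
      simp only [Set.indicator_apply, Set.mem_setOf_eq, Pi.one_apply]
  rw [prod_doubleCurrentMeasure_apply G hβ hox h0 hax h0,
    doubleCurrentMeasure_apply_eq_tsum_epairWeight_div G β hβ _ _ hox hax]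
  calc _ ≤ (ecurrentSum (fun _ : G.edgeFinset => β) (∅ : Finset V) ^ 2 *
        ∑' p : Current G × Current G, epairWeight (fun _ : G.edgeFinset => β) ({o} ∆ {x}) ({a} ∆ {x'}) p *
          Set.indicator {p | a ∉ (p.1 + p.2).cluster o} 1 p) /
        (ecurrentSum (fun _ : G.edgeFinset => β) ({o} ∆ {x}) * ecurrentSum (fun _ : G.edgeFinset => β) ∅ *
          (ecurrentSum (fun _ : G.edgeFinset => β) ({a} ∆ {x'}) *
            ecurrentSum (fun _ : G.edgeFinset => β) ∅)) := ENNReal.div_le_div_right key' _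
    _ = _ := by
      rw [show ecurrentSum (fun _ : G.edgeFinset => β) ({o} ∆ {x}) * ecurrentSum (fun _ : G.edgeFinset => β) ∅ *
          (ecurrentSum (fun _ : G.edgeFinset => β) ({a} ∆ {x'}) * ecurrentSum (fun _ : G.edgeFinset => β) ∅) =
          ecurrentSum (fun _ : G.edgeFinset => β) (∅ : Finset V) ^ 2 *
            (ecurrentSum (fun _ : G.edgeFinset => β) ({o} ∆ {x}) *
              ecurrentSum (fun _ : G.edgeFinset => β) ({a} ∆ {x'})) by ring,
        ENNReal.mul_div_mul_left _ _ (pow_ne_zero 2 hZ0) (ENNReal.pow_ne_top (hZtop _))]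

/-! ## The free box: lifted traces -/

/-- **The sandwich for the lifted traces in the free box `Λ_n` at `β_c`.** For box vertices
`o x a x' ∈ Λ_n`: the product of the trace laws `P^{ox,∅}_{Λ_n} ⊗ P^{ax',∅}_{Λ_n}` gives the event
"the two duplicated clusters of `↑o` and `↑a` share no site of `ℤ³`" at most the mass that the trace law
`P^{ox,ax'}_{Λ_n}` gives to `{↑o ↮ ↑a}` (lifting does not change connections). [cite: AizenmanDuminilCopinAnnals2021, eq. (3.13) and App. A Lemma A.1] -/
theorem fourTrace_compl_meet_le (hDS : DoubleSandwich) (n : ℕ) (o x a x' : BoxVertex 3 n)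
    (ho : (o : Site 3) ∈ box 3 n) (hx : (x : Site 3) ∈ box 3 n) (ha : (a : Site 3) ∈ box 3 n)
    (hx' : (x' : Site 3) ∈ box 3 n) :
    ((sourcedDoubleCurrentLaw 3 n βc ({(o : Site 3)} ∆ {(x : Site 3)}) ∅).prod
        (sourcedDoubleCurrentLaw 3 n βc ({(a : Site 3)} ∆ {(x' : Site 3)}) ∅))
      {ω | ∃ u : Site 3, u ∈ openCluster ω.1 (o : Site 3) ∧ u ∈ openCluster ω.2 (a : Site 3)}ᶜ ≤
    (sourcedDoubleCurrentLaw 3 n βc ({(o : Site 3)} ∆ {(x : Site 3)}) ({(a : Site 3)} ∆ {(x' : Site 3)}))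
      (openConn (o : Site 3) (a : Site 3))ᶜ := by
  have hβ : 0 ≤ βc := criticalBeta_nonneg 3
  have hcsA := currentSum_pair_ne_zero o x ho hx
  have hcsB := currentSum_pair_ne_zero a x' ha hx'
  have hcs0 := currentSum_empty_ne_zero n
  haveI := isProbabilityMeasure_doubleCurrentMeasure_holds (freeBoxGraph 3 n) hβ hcsA hcs0
  haveI := isProbabilityMeasure_doubleCurrentMeasure_holds (freeBoxGraph 3 n) hβ hcsB hcs0
  have hsT : Measurable (sourcedTrace 3 n) := measurable_sourcedTrace n
  have hE : MeasurableSet {ω : BondConfig (Site 3) × BondConfig (Site 3) |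
      ∃ u : Site 3, u ∈ openCluster ω.1 (o : Site 3) ∧ u ∈ openCluster ω.2 (a : Site 3)} :=
    measurableSet_meet ![(o : Site 3), (x : Site 3), (a : Site 3), (x' : Site 3)]
  simp only [sourcedDoubleCurrentLaw, boxSources_pair, boxSources_empty]
  rw [Measure.map_prod_map _ _ hsT hsT, Measure.map_apply (hsT.prodMap hsT) hE.compl,
    Measure.map_apply hsT (measurableSet_openConn_holds _ _).compl]
  refine le_trans (measure_mono ?_)
    (le_trans (sandwich_prob (freeBoxGraph 3 n) hDS hβ o x a x' hcsA hcsB hcs0) (measure_mono ?_))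
  · intro q hq
    simp only [Set.mem_preimage, Set.mem_compl_iff, Set.mem_setOf_eq, Prod.map_fst, Prod.map_snd,
      not_exists, not_and, openCluster, sourcedTrace] at hq
    rw [Set.mem_setOf_eq, Finset.disjoint_left]
    intro v hv1 hv2
    rw [Current.mem_cluster_iff] at hv1 hv2
    exact hq v (reachable_liftBonds 3 hv1) (reachable_liftBonds 3 hv2)
  · intro p hp hconn
    exact hp (Current.mem_cluster_iff.2 ((liftBonds_mem_openConn_iff 3 _ o a).1 hconn))

end OnePinchDecayProof

open scoped symmDiff
open MeasureTheory
open Literature.Probability.LatticeModels Literature.Probability.Percolation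
open Summit.CriticalPhenomena.Ising3DConformalLimit.GapForcesFarMergingSandwich

/-- **Dictionary of the line (helper of `stub_onePinchDecay`).** Under `DoubleSandwich`, for every box
size `n` and every quadruple `y` of points of `Λ_n`, the duplicated avoidance probability of the two
independent lifted traces is at most the two-current avoidance probability:
`avoid n y ≤ 1 - merge n y`, i.e.
`P^{y₀y₁,∅}⊗P^{y₂y₃,∅}_{Λ_n}[C_{n₁+n₂}(y₀) ∩ C_{n₃+n₄}(y₂) = ∅] ≤ P^{y₀y₁,y₂y₃}_{Λ_n}[y₀ ↮ y₂ in n₁+n₃]`.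
[cite: AizenmanDuminilCopinAnnals2021, eq. (3.13) and App. A Lemma A.1] -/
theorem onePinchDecay_avoid_le_one_sub_merge :
    DoubleSandwich → ∀ (n : ℕ) (y : Fin 4 → Site 3), (∀ i, y i ∈ box 3 n) →
      avoid n y ≤ 1 - merge n y := by
  intro hDS n y hy
  have hb : ∀ i, y i ∈ box 3 (n + 1) := fun i => box_subset_box_succ 3 n (hy i)
  have hβpos : 0 < βc := criticalBeta_pos_holds (d := 3) (by norm_num)
  haveI : IsProbabilityMeasure (sourcedDoubleCurrentLaw 3 n βc ({y 0} ∆ {y 1}) ({y 2} ∆ {y 3})) :=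
    isProbabilityMeasure_sourcedDoubleCurrentLaw (criticalBeta_nonneg 3)
      (currentSum_boxSources_pos 3 hβpos (OnePinchDecayProof.pair_subset_box (hy 0) (hy 1))
        (even_card_singleton_symmDiff _ _)).ne'
      (currentSum_boxSources_pos 3 hβpos (OnePinchDecayProof.pair_subset_box (hy 2) (hy 3))
        (even_card_singleton_symmDiff _ _)).ne'
  have h : (fourTraceLaw n y) (Meet y)ᶜ ≤
      (sourcedDoubleCurrentLaw 3 n βc ({y 0} ∆ {y 1}) ({y 2} ∆ {y 3})) (openConn (y 0) (y 2))ᶜ :=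
    OnePinchDecayProof.fourTrace_compl_meet_le hDS n ⟨y 0, hb 0⟩ ⟨y 1, hb 1⟩ ⟨y 2, hb 2⟩ ⟨y 3, hb 3⟩
      (hy 0) (hy 1) (hy 2) (hy 3)
  have hset : {ω : BondConfig (Site 3) | y 2 ∈ openCluster ω (y 0)} = openConn (y 0) (y 2) := rfl
  rw [avoid, merge, hset, ← probReal_compl_eq_one_sub (measurableSet_openConn_holds _ _)]
  simp only [measureReal_def]
  exact ENNReal.toReal_mono (measure_ne_top _ _) h

end Summit.CriticalPhenomena.Ising3DConformalLimit.EnergyNotSigmaSquaredGapForcesFarMergingSandwich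

end
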